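import Mathlib
import HarnessLib
import Summits.ValiantsHypothesis.ValiantsHypothesis.Theorems.MonotoneRestorationMonotoneRestorationQPLinearWidthCFIHomMonotoneWeighted
import Summits.ValiantsHypothesis.ValiantsHypothesis.Theorems.MonotoneRestorationMonotoneRestorationQPLinearWidthHomIndistShift
import Summits.ValiantsHypothesis.ValiantsHypothesis.Theorems.MonotoneRestorationMonotoneRestorationQPLinearWidthCFIHomMonotoneCapstone

/-!
# Route MonotoneRestoration, crux `MonotoneRestorationQP` (stmt-15886), line `linear_width` —
# AFFINE (WEIGHTED) CFI WITNESSES: SUBGRAPH CONTAINMENT OF A 2-SUBDIVIDED WIDE BASE SUFFICES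

Helper file (`--supports stmt-ValiantsHypothesis-15886`), def-free.

The `√N` rung of the line (`CFIHomMonotone.widthRung_sqrt_of_linearWitness₂`, p841464/p841477) consumes linear-size
`HomIndist`-witnesses for every wide bipartite pattern.  The witnesses in the tree (retract witnesses p841399/`…Weighted`,
apex witnesses p841446/p841497, capstone p841567) need the 2-subdivision `G₂` of a wide base as a RETRACT resp. as an
INDUCED subgraph of the pattern — which DENSE wide patterns (`K_{d,d}`, no induced `P₄`) never have (census CENSUS-g13,
"dense wide patterns need a different witness family").  This file supplies that family, using the one freedom the line's
hypothesis `PolylogHomDetermined` grants and the simple-graph witnesses do not use: WEIGHTS.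

THE AFFINE PAIR.  For the CFI pair `X = CFI(G,∅)`, `Y = CFI(G,{e})` (hosts on `Fin ν`, `ν = |CFI(G)|`) take the points
`z = 𝟙_X + J`, `z' = 𝟙_Y + J` of `ℂ^{ν×ν}` (weight `2` on edges, `1` on non-edges).  By the sub-pattern expansion
(`HomIndistShift.eval_homPoly_add_const`) `hom_E(𝟙_X + J) = Σ_{T ≤ E} hom_T(𝟙_X) = Σ_{T ≤ E} #Hom(patternGraph T, X)`,
so

* `homIndist` of the pair is inherited from the `0/1` pair (`HomIndistShift.homIndist_add_const`, Dvořák in the tree);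
* `hom_E(z) − hom_E(z') = Σ_{T ≤ E} (#Hom(T, X) − #Hom(T, Y))` is a sum of NONNEGATIVE terms (Roberson monotonicity for
  every sub-pattern, `CFIHomMonotone.card_hom_cfiGraph_le`) one of which is POSITIVE as soon as SOME sub-pattern `T ≤ E`
  retracts onto `G₂` (`CFIHomMonotone.card_hom_cfiGraph_lt_of_retract`) — and if `G₂` maps INJECTIVELY into
  `patternGraph E` (subgraph containment, induced or not), the sub-pattern `E₀` of the image edges does
  (`exists_subpattern_retract`: the other vertices are isolated in `patternGraph E₀` and go anywhere).

Results:
* `exists_subpattern_retract` — an injective homomorphism `S →g patternGraph E` yields `E₀ ≤ E` with `S` a retract of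
  `patternGraph E₀`;
* `exists_fin_hosts` — the CFI pair over a connected base `G` (`tw G ≥ k ≥ 1`) transported to `Fin |CFI(G)|`:
  `C^k`-equivalent, hom-monotone for EVERY source graph, strict for retracts of `G₂`;
* `exists_homIndist_affineWitness_of_injective` — **for every bipartite pattern `E` whose pattern graph contains `G₂` as a
  (not necessarily induced) SUBGRAPH, a `HomIndist ν k`-pair separating `hom_E` exists at level `ν = |CFI(G)|`**
  (`≤ v·2^Δ + 2vΔ`, `_le` form) — no apex, no inducedness;
* `linearWitness_of_subdivisions`, `widthRung_sqrt_of_subdivisions` — the capstone with (IND₂) weakened to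
  **(SUB₂)_{C,g}**: every isolated-free wide pattern contains `subdiv B` as a SUBGRAPH for a connected wide base `B` with
  `|CFI(B)| ≤ C(a+b+1)`; then `WidthRung (fun n => Nat.sqrt n / (3C+3))`.

Placement (honest label).  (SUB₂) is implied by (IND₂) and, unlike it, is not refuted by dense patterns: `K_{d,d}` contains
every bipartite graph on `≤ d + d` vertices as a subgraph, in particular 2-subdivided walls.  What (SUB₂) still needs for
ALL patterns is the topological-minor form of the excluded-grid theorem (large tree-width ⇒ a subdivided wall as a
subgraph; polynomial bounds: Chekuri–Chuzhoy 2016) plus a re-embedding of an arbitrarily subdivided wall onto an exactly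
2-subdivided wide base — in print / elementary, not in the tree.  No stub closed; θ₁, the cruxes and VP ≠ VNP NOT moved.
[cite: ChenFlumLiu2025, Thm 11.1, Thm 12.2; Roberson2022, Thm 3.6; Dvorak2010, Thm 6; DawarPagoSeppelt2025, §6–7]
-/

set_option linter.dupNamespace false

noncomputable section

open scoped Classical

namespace Summit.ValiantsHypothesis.ValiantsHypothesis.Theorems.AffineWitness

open MvPolynomial
open Literature.ModelTheory.FiniteModelTheory Literature.ModelTheory.FiniteModelTheory.ChenFlumLiu2025
open Literature.Computability.AlgebraicComplexity
open Summit.ValiantsHypothesis.ValiantsHypothesis.Theorems.MonotoneRestorationQPLinearWidth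
open Summit.ValiantsHypothesis.ValiantsHypothesis.Theorems.CFIHomMonotone

/-! ### Sub-patterns retracting onto an injectively embedded graph -/

/-- **An injective homomorphism `σ : S → patternGraph E` makes `S` a retract of a SUB-pattern**: the multiset `E₀ ≤ E` of
the image edges (one copy each) has `patternGraph E₀ =` the image of `S` plus isolated vertices, `σ` corestricts to it, and
a left inverse of `σ` (arbitrary off the image) is a retraction. [folklore] -/
theorem exists_subpattern_retract {a b : ℕ} (E : Multiset (Fin a × Fin b)) {W : Type*} [Nonempty W]
    {S : SimpleGraph W} (σ : S →g patternGraph E) (hσ : Function.Injective σ) :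
    ∃ E₀ : Multiset (Fin a × Fin b), E₀ ≤ E ∧
      ∃ (ι : S →g patternGraph E₀) (ρ : patternGraph E₀ →g S), ∀ x, ρ (ι x) = x := by
  set E₀ : Multiset (Fin a × Fin b) :=
    E.dedup.filter fun p => ∃ x y, S.Adj x y ∧ σ x = Sum.inl p.1 ∧ σ y = Sum.inr p.2 with hE₀
  have hle : E₀ ≤ E := (Multiset.filter_le _ _).trans (Multiset.dedup_le E)
  -- the corestriction of `σ`
  have hι : ∀ x y, S.Adj x y → (patternGraph E₀).Adj (σ x) (σ y) := by
    intro x y hxy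
    have h := σ.map_rel hxy
    simp only [patternGraph, SimpleGraph.fromRel_adj] at h ⊢
    refine ⟨h.1, ?_⟩
    rcases h.2 with ⟨p, hp, hu, hv⟩ | ⟨p, hp, hu, hv⟩
    · refine Or.inl ⟨p, ?_, hu, hv⟩
      rw [hE₀, Multiset.mem_filter]
      exact ⟨Multiset.mem_dedup.2 hp, x, y, hxy, hu, hv⟩
    · refine Or.inr ⟨p, ?_, hu, hv⟩
      rw [hE₀, Multiset.mem_filter]
      exact ⟨Multiset.mem_dedup.2 hp, y, x, hxy.symm, hu, hv⟩
  -- the retraction: a left inverse of `σ`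
  have hρ : ∀ q q', (patternGraph E₀).Adj q q' →
      S.Adj (Function.invFun σ q) (Function.invFun σ q') := by
    intro q q' hqq'
    simp only [patternGraph, SimpleGraph.fromRel_adj] at hqq'
    have key : ∀ p ∈ E₀, ∀ q q' : Fin a ⊕ Fin b, q = Sum.inl p.1 → q' = Sum.inr p.2 →
        S.Adj (Function.invFun σ q) (Function.invFun σ q') := by
      intro p hp q q' hq hq'
      rw [hE₀, Multiset.mem_filter] at hp
      obtain ⟨-, x, y, hxy, hx, hy⟩ := hp
      rw [hq, hq', ← hx, ← hy, Function.leftInverse_invFun hσ x, Function.leftInverse_invFun hσ y]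
      exact hxy
    rcases hqq'.2 with ⟨p, hp, hu, hv⟩ | ⟨p, hp, hu, hv⟩
    · exact key p hp q q' hu hv
    · exact (key p hp q' q hu hv).symm
  exact ⟨E₀, hle, ⟨σ, fun {x y} h => hι x y h⟩, ⟨Function.invFun σ, fun {q q'} h => hρ q q' h⟩,
    fun x => Function.leftInverse_invFun hσ x⟩

/-! ### The CFI pair on a standard vertex set, with monotonicity for all sources -/

variable {v : ℕ} {G : SimpleGraph (Fin v)}

/-- **The CFI hosts on `Fin |CFI(G)|`.**  For `G` connected on `≥ 2` vertices with `tw G ≥ k ≥ 1` and an edge `e`: the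
transported pair `X ≅ CFI(G,∅)`, `Y ≅ CFI(G,{e})` is `C^k`-equivalent (Chen–Flum–Liu Thm 11.1, proved in the tree),
`hom(F, Y) ≤ hom(F, X)` for EVERY finite `F` (Roberson monotonicity), and `<` whenever `G₂` is a retract of `F`.
[cite: ChenFlumLiu2025, Thm 11.1, Thm 12.2; Roberson2022, Thm 3.6] -/
theorem exists_fin_hosts {k : ℕ} (hconn : G.Connected) (h2 : 2 ≤ v) (hk : 1 ≤ k)
    (htw : k ≤ Literature.Combinatorics.SimpleGraph.treewidth G) (hE : G.edgeSet.Nonempty) :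
    ∃ (m : ℕ) (X Y : SimpleGraph (Fin m)), m = Fintype.card (CFIVertex G) ∧ CkEquiv k X Y ∧
      (∀ (W : Type) [Finite W] (F : SimpleGraph W), Nat.card (F →g Y) ≤ Nat.card (F →g X)) ∧
      (∀ (W : Type) [Finite W] (F : SimpleGraph W) (ι : subdiv G →g F) (ρ : F →g subdiv G),
        (∀ x, ρ (ι x) = x) → Nat.card (F →g Y) < Nat.card (F →g X)) := by
  obtain ⟨e, he⟩ := hE
  let φ := Fintype.equivFin (CFIVertex G)
  have hck := (ChenFlumLiu2025_ckEquiv_of_le_treewidth_holds v k G hconn h2 hk htw e he).iso_congr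
    (SimpleGraph.Iso.map φ (cfiEven G)) (SimpleGraph.Iso.map φ (cfiGraph G ({e} : Set (Sym2 (Fin v)))))
  refine ⟨Fintype.card (CFIVertex G), _, _, rfl, hck, fun W _ F => ?_, fun W _ F ι ρ hρι => ?_⟩
  · rw [← card_hom_congr_right F (SimpleGraph.Iso.map φ (cfiEven G)),
      ← card_hom_congr_right F (SimpleGraph.Iso.map φ (cfiGraph G ({e} : Set (Sym2 (Fin v)))))]
    exact card_hom_cfiGraph_le F ({e} : Set (Sym2 (Fin v)))
  · rw [← card_hom_congr_right F (SimpleGraph.Iso.map φ (cfiEven G)),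
      ← card_hom_congr_right F (SimpleGraph.Iso.map φ (cfiGraph G ({e} : Set (Sym2 (Fin v)))))]
    exact card_hom_cfiGraph_lt_of_retract F he ι ρ hρι

/-! ### The affine pair `𝟙_X + J`, `𝟙_Y + J` -/

/-- **`hom_E` at `𝟙_Γ + J` counts homomorphisms of all sub-patterns**:
`hom_E(𝟙_Γ + J) = Σ_{(T,T') ∈ antidiagonal E} #Hom(patternGraph T, Γ)`. [cite: Dvorak2010, Thm 6] -/
theorem eval_indicator_add_one_homPoly {a b m : ℕ} (E : Multiset (Fin a × Fin b)) (Γ : SimpleGraph (Fin m)) :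
    eval (fun x => Set.indicator {ij : Fin m × Fin m | Γ.Adj ij.1 ij.2} (1 : Fin m × Fin m → ℂ) x + 1)
        (homPoly E m ℂ) =
      ((((Multiset.antidiagonal E).map fun p => Nat.card (patternGraph p.1 →g Γ)).sum : ℕ) : ℂ) := by
  rw [HomIndistShift.eval_homPoly_add_const, Nat.cast_multiset_sum, Multiset.map_map]
  refine congrArg _ (Multiset.map_congr rfl fun p _ => ?_)
  rw [Function.comp_apply, one_pow, one_mul, SimpleGraphCut.eval_indicator_homPoly]

/-- **Monotone sums with one strict term are strict**: if `g ≤ f` termwise on `s` and `g p₀ < f p₀` for some `p₀ ∈ s`, then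
`Σ_s g < Σ_s f`. [folklore] -/
theorem sum_map_lt_of_le_of_lt {α : Type*} (s : Multiset α) (f g : α → ℕ) (hle : ∀ p ∈ s, g p ≤ f p)
    {p₀ : α} (hp₀ : p₀ ∈ s) (hlt : g p₀ < f p₀) : (s.map g).sum < (s.map f).sum := by
  obtain ⟨t, rfl⟩ := Multiset.exists_cons_of_mem hp₀
  rw [Multiset.map_cons, Multiset.map_cons, Multiset.sum_cons, Multiset.sum_cons]
  exact add_lt_add_of_lt_of_le hlt
    (Multiset.sum_map_le_sum_map _ _ fun p hp => hle p (Multiset.mem_cons_of_mem hp))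

/-- **THE AFFINE WITNESSES (unconditional).**  Let `G` be connected on `≥ 2` vertices with `tw G ≥ k ≥ 1` and an edge, and
let the 2-subdivision `G₂` map INJECTIVELY into the pattern graph of `E` (subgraph containment, induced or not).  Then at
level `ν = |CFI(G)|` there are `HomIndist ν k`-related points `z, z'` of `ℂ^{ν×ν}` (the CFI pair with weight `2` on edges
and `1` on non-edges) with `hom_E(z) ≠ hom_E(z')`. [cite: ChenFlumLiu2025, Thm 11.1, Thm 12.2; Roberson2022, Thm 3.6; Dvorak2010, Thm 6] -/
theorem exists_homIndist_affineWitness_of_injective {a b k : ℕ} (E : Multiset (Fin a × Fin b))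
    (hconn : G.Connected) (h2 : 2 ≤ v) (hk : 1 ≤ k)
    (htw : k ≤ Literature.Combinatorics.SimpleGraph.treewidth G) (hE : G.edgeSet.Nonempty)
    (σ : subdiv G →g patternGraph E) (hσ : Function.Injective σ) :
    ∃ (ν : ℕ) (z z' : Fin ν × Fin ν → ℂ), ν = Fintype.card (CFIVertex G) ∧ HomIndist ν k z z' ∧
      eval z (homPoly E ν ℂ) ≠ eval z' (homPoly E ν ℂ) := by
  haveI : Nonempty (Fin v ⊕ Dart G) := ⟨Sum.inl ⟨0, by omega⟩⟩
  obtain ⟨E₀, hE₀, ι, ρ, hρι⟩ := exists_subpattern_retract E σ hσ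
  obtain ⟨m, X, Y, hm, hXY, hmono, hstrict⟩ := exists_fin_hosts hconn h2 hk htw hE
  refine ⟨m, fun x => Set.indicator {ij : Fin m × Fin m | X.Adj ij.1 ij.2} (1 : Fin m × Fin m → ℂ) x + 1,
    fun x => Set.indicator {ij : Fin m × Fin m | Y.Adj ij.1 ij.2} (1 : Fin m × Fin m → ℂ) x + 1, hm,
    HomIndistShift.homIndist_add_const (SimpleGraphCut.homIndist_indicator_of_ckEquiv hXY) 1, ?_⟩
  rw [eval_indicator_add_one_homPoly, eval_indicator_add_one_homPoly, Ne, Nat.cast_inj]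
  apply ne_of_gt
  -- the sub-pattern `(E₀, U)` with `E = E₀ + U` is the strict term
  obtain ⟨U, hU⟩ := Multiset.le_iff_exists_add.1 hE₀
  have hp₀ : (E₀, U) ∈ Multiset.antidiagonal E := by
    rw [Multiset.mem_antidiagonal, hU]
  exact sum_map_lt_of_le_of_lt _ _ _ (fun p _ => hmono _ (patternGraph p.1)) hp₀
    (hstrict _ (patternGraph E₀) ι ρ hρι)

/-- **Linear size, explicitly**: the level of the affine witnesses is at most `v·2^Δ + 2vΔ` for a base on `Fin v` of maximum
degree `Δ` (`≤ 14v` for subcubic bases, `≤ 24v` for grids and walls). [cite: CaiFurerImmerman1992, §6] -/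
theorem exists_homIndist_affineWitness_le {a b k : ℕ} (E : Multiset (Fin a × Fin b))
    (hconn : G.Connected) (h2 : 2 ≤ v) (hk : 1 ≤ k)
    (htw : k ≤ Literature.Combinatorics.SimpleGraph.treewidth G) (hE : G.edgeSet.Nonempty)
    (σ : subdiv G →g patternGraph E) (hσ : Function.Injective σ) :
    ∃ (ν : ℕ) (z z' : Fin ν × Fin ν → ℂ), ν ≤ v * 2 ^ G.maxDegree + 2 * (v * G.maxDegree) ∧ HomIndist ν k z z' ∧
      eval z (homPoly E ν ℂ) ≠ eval z' (homPoly E ν ℂ) := by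
  obtain ⟨ν, z, z', hν, hzz', hne⟩ := exists_homIndist_affineWitness_of_injective E hconn h2 hk htw hE σ hσ
  exact ⟨ν, z, z', hν ▸ card_cfiVertex_le, hzz', hne⟩

/-- An induced copy is in particular a subgraph: the affine witnesses cover the apex witnesses' patterns (at a level smaller
by `2`). [folklore] -/
theorem exists_homIndist_affineWitness_of_embedding {a b k : ℕ} (E : Multiset (Fin a × Fin b))
    (hconn : G.Connected) (h2 : 2 ≤ v) (hk : 1 ≤ k)
    (htw : k ≤ Literature.Combinatorics.SimpleGraph.treewidth G) (hE : G.edgeSet.Nonempty)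
    (ι : subdiv G ↪g patternGraph E) :
    ∃ (ν : ℕ) (z z' : Fin ν × Fin ν → ℂ), ν = Fintype.card (CFIVertex G) ∧ HomIndist ν k z z' ∧
      eval z (homPoly E ν ℂ) ≠ eval z' (homPoly E ν ℂ) :=
  exists_homIndist_affineWitness_of_injective E hconn h2 hk htw hE ι.toHom ι.injective

/-! ### The capstone with subgraph containment: (SUB₂) ⇒ the `√N` rung -/

/-- **(SUB₂) ⇒ (W1-lin) at every width `k ≥ 1`**: 2-subdivided wide bases contained as SUBGRAPHS in every wide pattern give
linear-size `HomIndist` witnesses (the affine witnesses). [cite: ChenFlumLiu2025, Thm 11.1, Thm 12.2] -/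
theorem linearWitness_of_subdivisions (C : ℕ) (g : ℕ → ℕ)
    (hSUB : ∀ (k a b : ℕ) (E : Multiset (Fin a × Fin b)), 1 ≤ k →
      (∀ u : Fin a, ∃ x ∈ E, x.1 = u) → (∀ w : Fin b, ∃ x ∈ E, x.2 = w) →
      g k ≤ Literature.Combinatorics.SimpleGraph.treewidth (patternGraph E) →
      ∃ (v : ℕ) (B : SimpleGraph (Fin v)), B.Connected ∧ 2 ≤ v ∧
        k ≤ Literature.Combinatorics.SimpleGraph.treewidth B ∧ B.edgeSet.Nonempty ∧
        Fintype.card (CFIVertex B) ≤ C * (a + b + 1) ∧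
        ∃ σ : subdiv B →g patternGraph E, Function.Injective σ)
    {k : ℕ} (hk : 1 ≤ k) (a b : ℕ) (E : Multiset (Fin a × Fin b))
    (hrow : ∀ u : Fin a, ∃ x ∈ E, x.1 = u) (hcol : ∀ w : Fin b, ∃ x ∈ E, x.2 = w)
    (htw : g k ≤ Literature.Combinatorics.SimpleGraph.treewidth (patternGraph E)) :
    ∃ ν : ℕ, ν ≤ C * (a + b + 1) ∧ ∃ z z' : Fin ν × Fin ν → ℂ, HomIndist ν k z z' ∧
      eval z (homPoly E ν ℂ) ≠ eval z' (homPoly E ν ℂ) := by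
  obtain ⟨v, B, hconn, h2, htwB, hE, hcard, σ, hσ⟩ := hSUB k a b E hk hrow hcol htw
  obtain ⟨ν, z, z', hν, hzz', hne⟩ := exists_homIndist_affineWitness_of_injective E hconn h2 hk htwB hE σ hσ
  exact ⟨ν, hν ▸ hcard, z, z', hzz', hne⟩

/-- **THE CAPSTONE WITH SUBGRAPH CONTAINMENT: (SUB₂)_{C,g} with `g` polynomially bounded ⇒ the `√N` rung**
`WidthRung (fun n => Nat.sqrt n / (3C+3))`: every matrix-symmetric `VP` family of degree `≤ √n/(3C+3)` that is
`PolylogHomDetermined` has square-symmetric circuits of quasi-polynomial orbit size.  Same assembly as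
`CFIHomMonotone.widthRung_sqrt_of_inducedSubdivisions` (Kronecker isolation at level `C(2 deg + 1)`), with the affine
witnesses in place of the apex witnesses. [cite: DawarPagoSeppelt2025, Thm 7.3, Thm 7.9; DawarWilsenach2025, §3.3] -/
theorem widthRung_sqrt_of_subdivisions (C : ℕ) (g : ℕ → ℕ) (e : ℕ) (hg : ∀ k, g k ≤ (k + 2) ^ e)
    (hSUB : ∀ (k a b : ℕ) (E : Multiset (Fin a × Fin b)), 1 ≤ k →
      (∀ u : Fin a, ∃ x ∈ E, x.1 = u) → (∀ w : Fin b, ∃ x ∈ E, x.2 = w) →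
      g k ≤ Literature.Combinatorics.SimpleGraph.treewidth (patternGraph E) →
      ∃ (v : ℕ) (B : SimpleGraph (Fin v)), B.Connected ∧ 2 ≤ v ∧
        k ≤ Literature.Combinatorics.SimpleGraph.treewidth B ∧ B.edgeSet.Nonempty ∧
        Fintype.card (CFIVertex B) ≤ C * (a + b + 1) ∧
        ∃ σ : subdiv B →g patternGraph E, Function.Injective σ) :
    WidthRung fun n => Nat.sqrt n / (3 * C + 3) := by
  intro f hsym _hVP hdegle hdet
  obtain ⟨c₀, hc₀⟩ := hdet
  obtain ⟨c', hc'⟩ := SmallWitnessRung.exists_polylog_dominates c₀ e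
  refine ⟨c' + 3, fun N =>
    IsolationAnyLevel.qpOrbit_of_matrixSymmetric_of_smallDistinguishable₂ f c₀ c' hsym hc₀ (fun n => ?_) N⟩
  -- the degree budget: `deg · C(2 deg + 1) ≤ n` from `deg ≤ √n / (3C+3)`
  have hdeg : (f n).totalDegree * (C * (2 * (f n).totalDegree + 1)) ≤ n := by
    have h0 : (f n).totalDegree ≤ Nat.sqrt n / (3 * C + 3) := hdegle n
    set d := (f n).totalDegree with hd
    set s := Nat.sqrt n with hs
    have h1 : (3 * C + 3) * d ≤ s :=
      calc (3 * C + 3) * d ≤ (3 * C + 3) * (s / (3 * C + 3)) := Nat.mul_le_mul_left _ h0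
        _ ≤ s := Nat.mul_div_le s (3 * C + 3)
    have h2 : s * s ≤ n := Nat.sqrt_le n
    have h3 : d ≤ d * d := by
      rcases Nat.eq_zero_or_pos d with h | h
      · simp [h]
      · exact Nat.le_mul_of_pos_left d h
    have h4 : (3 * C + 3) * d * ((3 * C + 3) * d) ≤ s * s := Nat.mul_le_mul h1 h1
    nlinarith [h1, h2, h3, h4]
  -- the widths used are positive
  have hk1 : 1 ≤ (Nat.log 2 n + c₀) ^ c₀ := by
    rcases Nat.eq_zero_or_pos c₀ with h | h
    · simp [h]
    · exact Nat.one_le_pow _ _ (by omega)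
  refine ⟨C * (2 * (f n).totalDegree + 1), hdeg, fun a b E ha hb hrow hcol htw => ?_⟩
  obtain ⟨ν, hν, hwit⟩ := linearWitness_of_subdivisions C g hSUB hk1 a b E hrow hcol
    (le_trans ((hg _).trans (hc' (Nat.log 2 n))) htw)
  have hνle : ν ≤ C * (2 * (f n).totalDegree + 1) := hν.trans (Nat.mul_le_mul_left C (by omega))
  exact exists_homIndist_witness_mono E hrow hcol hνle hwit

end Summit.ValiantsHypothesis.ValiantsHypothesis.Theorems.AffineWitness

end
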